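import Summits.Ventures.HodgeRepro2.T5SmithFractionField
import Summits.Ventures.HodgeRepro2.T5CongruenceKernel

/-!
# Conjugating a principal congruence subgroup into `GL_n(R)`

Tier-5 kernel support (blind cell pub-hodge-repro2, seat p8, gen 11). Second step towards the
finiteness of `KgK/K` for `K = GL_n(R)` inside `GL_n(F)` (`F` the fraction field of `R`): for
every `g ∈ GL_n(F)` there is `c ∈ R ∖ {0}` with

`g⁻¹ · K(c) · g ⊆ K`, `K(c) = ker (GL_n(R) → GL_n(R ⧸ (c)))` the principal congruence subgroup.

Proof: clear denominators, `g = d⁻¹ g₀`, `g⁻¹ = d'⁻¹ g₀'` with `g₀, g₀'` integral; for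
`k₀ = 1 + (d d') B ∈ K(d d')` one has `g⁻¹ k₀ g = 1 + g₀' B g₀`, integral, and likewise for
`k₀⁻¹`; an invertible matrix with integral entries and integral inverse is in `GL_n(R)`.

* `mem_range_of_map_eq` — integral entries + integral inverse ⇒ in the image of `GL ι R`;
* `exists_conj_ker_le_range` — **the containment `g⁻¹ K(c) g ⊆ K`** for some `c ≠ 0`.

Hypotheses as stated in the kernel: `R` a commutative domain, `F` a field with
`[Algebra R F] [IsFractionRing R F]`, `ι` a finite type with decidable equality.
-/

namespace Summit.Ventures.HodgeRepro2.T5CongruenceConjugation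

open Matrix

variable {R : Type*} [CommRing R] {F : Type*} [Field F] [Algebra R F]
variable {ι : Type*} [Fintype ι] [DecidableEq ι]

/-- An invertible matrix over `F` whose entries and whose inverse's entries are the images of
integral matrices lies in the image of `GL ι R` (the map `R → F` being injective). -/
theorem mem_range_of_map_eq (hf : Function.Injective (algebraMap R F)) (u : GL ι F)
    (M M' : Matrix ι ι R) (hM : (u : Matrix ι ι F) = M.map (algebraMap R F))
    (hM' : ((u⁻¹ : GL ι F) : Matrix ι ι F) = M'.map (algebraMap R F)) :
    u ∈ (Matrix.GeneralLinearGroup.map (n := ι) (algebraMap R F)).range := by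
  have h1 : (M * M').map (algebraMap R F) = (1 : Matrix ι ι R).map (algebraMap R F) := by
    rw [Matrix.map_mul, ← hM, ← hM', Units.mul_inv, Matrix.map_one _ (map_zero _) (map_one _)]
  have hMM' : M * M' = 1 := Matrix.map_injective hf h1
  have hM'M : M' * M = 1 := mul_eq_one_comm.mp hMM'
  refine ⟨⟨M, M', hMM', hM'M⟩, ?_⟩
  ext i j
  rw [Matrix.GeneralLinearGroup.map_apply, hM, Matrix.map_apply]

variable [IsDomain R] [IsFractionRing R F]

/-- **Conjugating a congruence subgroup into `K`**: for `g ∈ GL ι F` there is `c ≠ 0` in `R`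
such that `g⁻¹ k₀ g ∈ K = GL_n(R)` for every `k₀` in the principal congruence subgroup `K(c)`. -/
theorem exists_conj_ker_le_range (g : GL ι F) :
    ∃ c : R, c ≠ 0 ∧ ∀ k₀ : GL ι R,
      k₀ ∈ (Matrix.GeneralLinearGroup.map (n := ι) (Ideal.Quotient.mk (Ideal.span {c}))).ker →
        g⁻¹ * Matrix.GeneralLinearGroup.map (algebraMap R F) k₀ * g ∈
          (Matrix.GeneralLinearGroup.map (n := ι) (algebraMap R F)).range := by
  obtain ⟨d, g₀, hd, hg₀⟩ :=
    T5SmithFractionField.exists_integer_matrix (R := R) (g : Matrix ι ι F)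
  obtain ⟨d', g₀', hd', hg₀'⟩ :=
    T5SmithFractionField.exists_integer_matrix (R := R) ((g⁻¹ : GL ι F) : Matrix ι ι F)
  have hinj : Function.Injective (algebraMap R F) := IsFractionRing.injective R F
  -- the key computation: `g⁻¹ (1 + (d d') B) g = 1 + g₀' B g₀`, with `d • g = g₀`, `d' • g⁻¹ = g₀'`
  have key : ∀ k₀ : GL ι R,
      k₀ ∈ (Matrix.GeneralLinearGroup.map (n := ι) (Ideal.Quotient.mk (Ideal.span {d * d'}))).ker →
      ∃ M : Matrix ι ι R,
        ((g⁻¹ * Matrix.GeneralLinearGroup.map (algebraMap R F) k₀ * g : GL ι F) : Matrix ι ι F) =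
          M.map (algebraMap R F) := by
    intro k₀ hk₀
    obtain ⟨B, hB⟩ := T5CongruenceKernel.exists_eq_one_add_smul_of_mem_ker (d * d') k₀ hk₀
    refine ⟨1 + g₀' * B * g₀, ?_⟩
    have e3 : ((1 : Matrix ι ι R) + (d * d') • B).map (algebraMap R F) =
        1 + algebraMap R F (d * d') • B.map (algebraMap R F) := by
      ext i j
      simp only [Matrix.map_apply, Matrix.add_apply, Matrix.smul_apply, Matrix.one_apply,
        smul_eq_mul, map_add, map_mul]
      split_ifs <;> simp
    rw [Units.val_mul, Units.val_mul, T5SmithFractionField.coe_map_eq_map, hB, e3,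
      Matrix.mul_add, Matrix.mul_one, Matrix.add_mul, Units.inv_mul, Matrix.mul_smul,
      Matrix.smul_mul, map_mul, mul_comm (algebraMap R F d) (algebraMap R F d'), mul_smul,
      ← Matrix.mul_smul, ← Matrix.smul_mul, ← Matrix.smul_mul, ← hg₀', ← hg₀, ← Matrix.map_mul,
      ← Matrix.map_mul, Matrix.map_add _ (map_add _), Matrix.map_one _ (map_zero _) (map_one _)]
  refine ⟨d * d', mul_ne_zero hd hd', fun k₀ hk₀ => ?_⟩
  obtain ⟨M, hM⟩ := key k₀ hk₀
  obtain ⟨M', hM'⟩ := key k₀⁻¹ (Subgroup.inv_mem _ hk₀)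
  refine mem_range_of_map_eq hinj _ M M' hM ?_
  rw [← hM']
  congr 1
  simp only [_root_.mul_inv_rev, inv_inv, map_inv, mul_assoc]

end Summit.Ventures.HodgeRepro2.T5CongruenceConjugation
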